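import Summits.QuantumFields.YangMills.Theorems.LuscherReductionDressedRitzLiftLeakageClosingDressed
import Summits.QuantumFields.YangMills.Theorems.LuscherReductionDressedRitzPolyakovLiftDressed
import HarnessLib

/-!
# Crux `DressedRitz` (stmt-QuantumFields-20205), line «polyakovlift» REV 3 (sha16 11209be61e7d2ff5), stub S-LEAK `stub_liftLeakage` — support IX:
# the press-button in the VERBATIM r3 currency (`PolyakovLift.dressedLiftVec ∕ dressedLiftFamily`, tree p529179)

Support module (fleet seat ym-20205-polyakovlift-s1; `--supports stmt-QuantumFields-20205`, helper, no closure claim).  The registered r3 text is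

  `Stmt.stub_liftLeakage :≡ ∀ k, ∃ C lam0, 0 ≤ C ∧ 0 < lam0 ∧ ∀ lam ∈ (0,lam0], ∃ L0, ∀ L ≥ L0, ∀ β, InFemtoWindow lam β L → ∀ φ, IsRawVacuum β φ →
     ∀ ω g, LiftBasis (liftCoupling β L) k ω g → LeakageClause k C β (dressedLiftFamily β φ g)`

(r2 text with `liftFamily ↦ dressedLiftFamily`; `dressedLiftFamily β φ g i = K_β^[dressSteps L] (liftVec β φ (g i))`, `dressSteps L = L`).  Part VIII
(`liftLeakage_of_referenceLaw_iterate`, over the explicit iterate with a free schedule `m`) specialises at `m := dressSteps` to this text; here it is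
spelled CHARACTER FOR CHARACTER over the tree defs, so the lead's discharge is literally
`theorem stub_liftLeakage : Stmt.stub_liftLeakage := LiftLeak.liftLeakage_dressed_of_referenceLaw h`:

* ★★★ `liftLeakage_dressed_of_referenceLaw`: hypothesis = the RG debt per `k` — `C ≥ 0`, `lam0 > 0`, and eventually in the window, at the
  Perron–Frobenius vacuum package `(Ω, θ)` (`Ω ≥ c > 0`): reference one-site data at `B₁ = liftCoupling β L` (positive raw vacuum `Ω₁`, exact orthonormal
  eigenfamily `ψ_0 … ψ_{N−1}`, levels `λ_n`, domination at `0 ≤ Λ < μ_k(B₁)`; the tree offers them with a WINDOW-UNIFORM `N`, `exists_reference_uniform`),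
  a CLUSTER-CONSTANT approximate eigenvalue `a`, rates `2Nρ ≤ C(λ³/L²)λ₀²`, `Nγ ≤ 1/2`, and for the DRESSED reference lifts `v_n = dressedLiftVec β Ω (ψ_n/Ω₁)`:
  (RL) `‖K_βv_n − a(λ_n)·v_n‖² ≤ ρ‖v_n‖²`, (GR) `|⟨v_n,v_{n'}⟩| ≤ γ‖v_n‖‖v_{n'}‖` (`n ≠ n'`, `λ_n = λ_{n'}`); conclusion = the text above.
* `leakageClause_dressed_of_residual`: `LeakageClause k C β (dressedLiftFamily β φ g)` from per-vector residual bounds (Part II for the dressed family).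

HONEST FRAMING: fixed-lattice bookkeeping on the conditional femto rung R2b1; (RL)∕(GR) for the dressed family are r3's OPEN RG ∕ Born–Oppenheimer
estimates; the stub stays OPEN; nothing here bears on infinite volume, the continuum limit or the Clay gap.  References: M. Lüscher, NPB 219 (1983) 233
[cite: Luscher1983, §3]; Lüscher–Wolff, NPB 339 (1990) 222 [cite: LuscherWolff1990]; T. Kato (1949) [cite: Kato1949, §1]; Reed–Simon IV [cite: ReedSimonIV1978, Thm XIII.1].
-/

set_option autoImplicit false

noncomputable section

open MeasureTheory Filter Topology Real Finset
open Literature.MathematicalPhysics.QuantumFieldTheory (GaugeConfig Site gaugeTransform)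
open scoped BigOperators

namespace Summit.QuantumFields.YangMills.Theorems.FemtoTransferGap.LiftLeak

open Summit.QuantumFields.YangMills.Theorems.FemtoTransferGap
open Summit.QuantumFields.YangMills.Theorems.FemtoTransferGap.PolyakovLift
open Summit.QuantumFields.YangMills.Theorems.FemtoTransferGap.VacDict

variable {L : ℕ} [NeZero L]

/-- **(o4) for the dressed family from per-vector residual bounds** (`PolyakovLift.LeakageClause k C β (dressedLiftFamily β φ g)` by name).
[cite: Kato1949, §1] -/
theorem leakageClause_dressed_of_residual {k : ℕ} (C β : ℝ) {φ : GaugeConfig 3 L SU2 → ℝ} (hφ : IsPhys φ)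
    {g : Fin k → (GaugeConfig 3 1 SU2 → ℝ)} (hg : ∀ i, IsPhys (g i))
    (h : ∀ i : Fin k, ∃ a : ℝ, l2 (transferApply β (dressedLiftFamily β φ g i) - a • dressedLiftFamily β φ g i)
        (transferApply β (dressedLiftFamily β φ g i) - a • dressedLiftFamily β φ g i) ≤
      C * (luscherLambda β L ^ 3 / (L : ℝ) ^ 2) * levelValue su2Rep L β 0 ^ 2 * l2 (dressedLiftFamily β φ g i) (dressedLiftFamily β φ g i)) :
    LeakageClause k C β (dressedLiftFamily β φ g) :=
  leakageClause_of_residual C β (fun i => isPhys_dressedLiftVec β hφ (hg i)) h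

/-- ★★★ **Registered r3 stub text of S-LEAK from the RG debt on ONE dressed reference family per lattice point** (hypothesis as in the module
docstring; conclusion = `Stmt.stub_liftLeakage` of skeleton r3 character for character; proof = Part VIII at `m := dressSteps`).
[cite: Luscher1983, §3] [cite: LuscherWolff1990] [cite: Kato1949, §1] [cite: ReedSimonIV1978, Thm XIII.1] -/
theorem liftLeakage_dressed_of_referenceLaw
    (h : ∀ k : ℕ, ∃ C lam0 : ℝ, 0 ≤ C ∧ 0 < lam0 ∧ ∀ lam : ℝ, 0 < lam → lam ≤ lam0 → ∃ L0 : ℕ,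
      ∀ (L : ℕ) [NeZero L], L0 ≤ L → ∀ β : ℝ, InFemtoWindow lam β L →
        ∀ (Ω : physSubmodule L) (θ c : ℝ), IsVacuum β Ω θ → 0 < c → (∀ U, c ≤ (Ω : GaugeConfig 3 L SU2 → ℝ) U) →
          ∃ (Ω₁ : GaugeConfig 3 1 SU2 → ℝ) (N : ℕ) (ψ : Fin N → (GaugeConfig 3 1 SU2 → ℝ)) (ev : Fin N → ℝ) (Λ : ℝ)
            (a : ℝ → ℝ) (ρ γ : ℝ),
            IsRawVacuum (liftCoupling β L) Ω₁ ∧ (∃ c₁ : ℝ, 0 < c₁ ∧ ∀ V, c₁ ≤ Ω₁ V) ∧ (∀ n, IsPhys (ψ n)) ∧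
            (∀ n n', l2 (ψ n) (ψ n') = if n = n' then 1 else 0) ∧ (∀ n, transferApply (liftCoupling β L) (ψ n) = ev n • ψ n) ∧
            0 ≤ Λ ∧ Λ < levelValue su2Rep 1 (liftCoupling β L) k ∧
            (∀ χ : GaugeConfig 3 1 SU2 → ℝ, IsPhys χ → (∀ n, l2 χ (ψ n) = 0) →
              l2 χ (transferApply (liftCoupling β L) χ) ≤ Λ * l2 χ χ) ∧
            0 ≤ ρ ∧ 0 ≤ γ ∧ (N : ℝ) * γ ≤ 1 / 2 ∧
            2 * N * ρ ≤ C * (luscherLambda β L ^ 3 / (L : ℝ) ^ 2) * levelValue su2Rep L β 0 ^ 2 ∧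
            (∀ n, l2 (transferApply β (dressedLiftVec β (Ω : GaugeConfig 3 L SU2 → ℝ) (ψ n / Ω₁)) -
                    a (ev n) • dressedLiftVec β (Ω : GaugeConfig 3 L SU2 → ℝ) (ψ n / Ω₁))
                  (transferApply β (dressedLiftVec β (Ω : GaugeConfig 3 L SU2 → ℝ) (ψ n / Ω₁)) -
                    a (ev n) • dressedLiftVec β (Ω : GaugeConfig 3 L SU2 → ℝ) (ψ n / Ω₁)) ≤
                ρ * l2 (dressedLiftVec β (Ω : GaugeConfig 3 L SU2 → ℝ) (ψ n / Ω₁)) (dressedLiftVec β (Ω : GaugeConfig 3 L SU2 → ℝ) (ψ n / Ω₁))) ∧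
            (∀ n n', n ≠ n' → ev n = ev n' →
              |l2 (dressedLiftVec β (Ω : GaugeConfig 3 L SU2 → ℝ) (ψ n / Ω₁)) (dressedLiftVec β (Ω : GaugeConfig 3 L SU2 → ℝ) (ψ n' / Ω₁))| ≤
                γ * (Real.sqrt (l2 (dressedLiftVec β (Ω : GaugeConfig 3 L SU2 → ℝ) (ψ n / Ω₁)) (dressedLiftVec β (Ω : GaugeConfig 3 L SU2 → ℝ) (ψ n / Ω₁))) *
                  Real.sqrt (l2 (dressedLiftVec β (Ω : GaugeConfig 3 L SU2 → ℝ) (ψ n' / Ω₁))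
                    (dressedLiftVec β (Ω : GaugeConfig 3 L SU2 → ℝ) (ψ n' / Ω₁)))))) :
    ∀ k : ℕ, ∃ C lam0 : ℝ, 0 ≤ C ∧ 0 < lam0 ∧ ∀ lam : ℝ, 0 < lam → lam ≤ lam0 → ∃ L0 : ℕ,
      ∀ (L : ℕ) [NeZero L], L0 ≤ L → ∀ β : ℝ, InFemtoWindow lam β L →
        ∀ φ : GaugeConfig 3 L SU2 → ℝ, IsRawVacuum β φ →
          ∀ (ω : GaugeConfig 3 1 SU2 → ℝ) (g : Fin k → (GaugeConfig 3 1 SU2 → ℝ)), LiftBasis (liftCoupling β L) k ω g →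
            LeakageClause k C β (dressedLiftFamily β φ g) :=
  liftLeakage_of_referenceLaw_iterate dressSteps h

end Summit.QuantumFields.YangMills.Theorems.FemtoTransferGap.LiftLeak

end
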